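import Literature.NumberTheory.EllipticCurves.IwasawaAlgebraProofs
import Literature.NumberTheory.GaloisRepresentations.PotentialDiagonalizabilityCriteriaProofs
import Mathlib.RingTheory.PowerSeries.WeierstrassPreparation
import Mathlib.RingTheory.AdjoinRoot
import HarnessLib

/-!
# The two-variable Iwasawa algebra `Λ₂ = ℤ_p⟦S⟧⟦T⟧`: Weierstrass finiteness over `ℤ_p⟦S⟧`
# (helper file 1 of the Λ₂ → Λ descent lemma for crux 2 `GoodLatticeBDPValue`, stmt-BirchSwinnertonDyer-19032, cell `bsd-eis` seat `bsd-eis-k5-c2`)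

Generic commutative algebra for the DESCENT from the two-variable Iwasawa algebra
`Λ₂ = ℤ_p⟦S, T⟧` to the one-variable algebra `Λ = ℤ_p⟦T⟧` along `S = 0` (the cell `bsd-eis` road
"Rubin 1991 two-variable main conjecture ⟹ one-variable anticyclotomic main conjecture", ky
MEMO-1 R2 (v); Skinner–Urban 2014 §3.1–3.2, Ochiai 2005 §3, Rubin *Euler systems* §VI).

MODEL.  `Λ₂ := PowerSeries (IwasawaAlgebra p) = (ℤ_p⟦S⟧)⟦T⟧`: the INNER variable `S` (the variable of
the coefficient ring `B := IwasawaAlgebra p = ℤ_p⟦S⟧`, embedded by `PowerSeries.C` = `algebraMap`)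
is the one killed by the descent; the OUTER variable `T = PowerSeries.X` survives.  The descent
homomorphism is `PowerSeries.map PowerSeries.constantCoeff : Λ₂ →+* Λ` (`S ↦ 0`), with section
`PowerSeries.map PowerSeries.C`.  (This is the opposite nesting to the receptacle
`CycAntiSeries = ℚ_p⟦T⟧⟦S⟧` of `TwoVariablePAdicLFunctionK.lean`; it is chosen because Mathlib's
Weierstrass division `PowerSeries.IsWeierstrassDivision` is division in the OUTER variable.)

CONTENT (theorems only, Mathlib + tree):
* `isAdicComplete_maximalIdeal_iwasawaAlgebra` : `ℤ_p⟦S⟧` is complete for its maximal ideal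
  `(p, S)` (tree `powerSeries_isAdicComplete_maximalIdeal` over Mathlib's completeness of `ℤ_p`),
  so that Mathlib's Weierstrass preparation applies over `B = ℤ_p⟦S⟧`;
* for `g ∈ Λ₂` with `g mod (p, S) ≠ 0` (equivalently: `g(S = 0) ∈ ℤ_p⟦T⟧` has `μ = 0`,
  `map_residue_ne_zero_iff`, with the same order `order_map_residue_eq`): `Λ₂ ⧸ (g)` is a FINITE
  FREE `ℤ_p⟦S⟧`-module of rank `ord (g mod (p, S))` = the `λ`-invariant of `g(S = 0)`
  (`finite_quotient`, `free_quotient`, `finrank_quotient`), by Weierstrass preparation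
  `g = f · u` over `B` and `B⟦T⟧/(g) ≅ B[T]/(f)` (Mathlib `algEquivQuotientWeierstrassDistinguished`,
  `AdjoinRoot.powerBasis'`).

What is NOT here: the descent theorem itself (`EisensteinPrimesTwoVariableDescent.lean`), pseudo-null
modules (`EisensteinPrimesTwoVariablePseudoNull.lean`), any Galois theory. HONEST FRAMING: generic
commutative algebra; closes nothing by itself (the crux's residue is MEMO-2 §5: [ALG], [AN]@𝟙, [BRω],
[BR𝟙]); this is the prover half of RULING L13 (k5-ty SPEC §1 row «descent (v)»).

References: Washington, *Introduction to Cyclotomic Fields*, §7.1 (Thm. 7.3) and §13.2;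
Bourbaki, *Algèbre commutative* VII §3.8–3.9; Matsumura, *Commutative Ring Theory*, Ex. 8.6.
-/

-- the summit namespace `Summit.BirchSwinnertonDyer.BirchSwinnertonDyer` repeats the problem name by design (D-0017)
set_option linter.dupNamespace false
set_option autoImplicit false

noncomputable section

open scoped Polynomial

open PowerSeries IsLocalRing Literature.NumberTheory.EllipticCurves

namespace Summit.BirchSwinnertonDyer.BirchSwinnertonDyer.Theorems.IwasawaTwoVariable

variable (p : ℕ) [Fact p.Prime]

/-! ## §1 Completeness of `ℤ_p⟦S⟧` for `(p, S)` -/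

/-- `B = ℤ_p⟦S⟧` is complete (and Hausdorff) for its maximal ideal `(p, S)`: `ℤ_p` is `p`-adically
complete (Mathlib) and power series over a complete local ring are complete for the maximal ideal
(tree `Literature.NumberTheory.GaloisRepresentations.powerSeries_isAdicComplete_maximalIdeal`;
Washington §7.1, Matsumura Ex. 8.6). Stated as a theorem (use `haveI`). [folklore] -/
theorem isAdicComplete_maximalIdeal_iwasawaAlgebra :
    IsAdicComplete (maximalIdeal (IwasawaAlgebra p)) (IwasawaAlgebra p) :=
  Literature.NumberTheory.GaloisRepresentations.powerSeries_isAdicComplete_maximalIdeal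

/-! ## §2 The residual order of `g ∈ Λ₂` and the `μ = 0` condition on `g(S = 0)` -/

/-- A coefficientwise criterion: `f ∈ ℤ_p⟦S⟧` lies in the maximal ideal `(p, S)` iff its constant
coefficient lies in `pℤ_p`, iff the residue of the constant coefficient vanishes. [folklore] -/
theorem residue_eq_zero_iff (f : IwasawaAlgebra p) :
    IsLocalRing.residue (IwasawaAlgebra p) f = 0 ↔
      IsLocalRing.residue ℤ_[p] (PowerSeries.constantCoeff f) = 0 := by
  rw [IsLocalRing.residue_eq_zero_iff, IsLocalRing.residue_eq_zero_iff, mem_maximalIdeal,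
    mem_maximalIdeal, mem_nonunits_iff, mem_nonunits_iff, PowerSeries.isUnit_iff_constantCoeff]

/-- For `g ∈ Λ₂ = ℤ_p⟦S⟧⟦T⟧`, the `j`-th coefficient of `g mod (p, S)` vanishes iff the `j`-th
coefficient of `g(S = 0) mod p` does. [folklore] -/
theorem coeff_map_residue_eq_zero_iff (g : PowerSeries (IwasawaAlgebra p)) (j : ℕ) :
    PowerSeries.coeff j (g.map (IsLocalRing.residue (IwasawaAlgebra p))) = 0 ↔
      PowerSeries.coeff j ((g.map (PowerSeries.constantCoeff (R := ℤ_[p]))).map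
        (IsLocalRing.residue ℤ_[p])) = 0 := by
  simp only [PowerSeries.coeff_map]
  exact residue_eq_zero_iff p _

/-- `g mod (p, S) ≠ 0` iff `g(S = 0) mod p ≠ 0` (i.e. iff `μ(g(S = 0)) = 0`). [folklore] -/
theorem map_residue_ne_zero_iff (g : PowerSeries (IwasawaAlgebra p)) :
    g.map (IsLocalRing.residue (IwasawaAlgebra p)) ≠ 0 ↔
      (g.map (PowerSeries.constantCoeff (R := ℤ_[p]))).map (IsLocalRing.residue ℤ_[p]) ≠ 0 := by
  rw [not_iff_not, PowerSeries.ext_iff, PowerSeries.ext_iff]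
  refine forall_congr' fun j => ?_
  rw [map_zero, map_zero]
  exact coeff_map_residue_eq_zero_iff p g j

/-- The residual order of `g ∈ Λ₂` (order of `g mod (p, S)` in `𝔽_p⟦T⟧`) equals the order of
`g(S = 0) mod p`, i.e. the `λ`-invariant of the one-variable series `g(S = 0)` when `μ = 0`.
[folklore] -/
theorem order_map_residue_eq (g : PowerSeries (IwasawaAlgebra p)) :
    (g.map (IsLocalRing.residue (IwasawaAlgebra p))).order =
      ((g.map (PowerSeries.constantCoeff (R := ℤ_[p]))).map (IsLocalRing.residue ℤ_[p])).order := by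
  by_cases h : g.map (IsLocalRing.residue (IwasawaAlgebra p)) = 0
  · have h' : (g.map (PowerSeries.constantCoeff (R := ℤ_[p]))).map (IsLocalRing.residue ℤ_[p]) = 0 := by
      by_contra h'
      exact ((map_residue_ne_zero_iff p g).2 h') h
    rw [h, h', PowerSeries.order_zero, PowerSeries.order_zero]
  · obtain ⟨n, hn⟩ := ENat.ne_top_iff_exists.1 (PowerSeries.order_finite_iff_ne_zero.2 h).ne
    rw [← hn]
    symm
    rw [PowerSeries.order_eq_nat]
    have hn' := hn.symm
    rw [PowerSeries.order_eq_nat] at hn'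
    refine ⟨fun h0 => hn'.1 ((coeff_map_residue_eq_zero_iff p g n).2 h0), fun i hi => ?_⟩
    exact (coeff_map_residue_eq_zero_iff p g i).1 (hn'.2 i hi)

/-! ## §3 Weierstrass: `A⟦X⟧ ⧸ (g)` is finite free over a complete local ring `A`

Stated for an arbitrary complete local ring `A` (applied with `A = ℤ_p⟦S⟧`, §1); keeping `A`
abstract avoids the two `Algebra ℤ_p⟦X⟧ ℤ_p⟦X⟧⟦X⟧` structures of Mathlib (`PowerSeries.C` versus
`PowerSeries.algebraPowerSeries = PowerSeries.map C`) ever competing: here `A⟦X⟧` is an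
`A`-algebra through constants only. -/

section Quotient

variable {A : Type*} [CommRing A] [IsLocalRing A] [IsAdicComplete (maximalIdeal A) A]
variable {g : PowerSeries A} (hg : g.map (IsLocalRing.residue A) ≠ 0)
include hg

/-- The Weierstrass polynomial of `g` (`g mod 𝔪_A ≠ 0`) over the complete local ring `A` is monic.
[folklore] -/
theorem monic_weierstrassDistinguished : (g.weierstrassDistinguished hg).Monic :=
  (g.isDistinguishedAt_weierstrassDistinguished hg).monic

/-- The degree of the Weierstrass polynomial of `g` is the residual order of `g`
(Washington Thm. 7.3). [folklore] -/
theorem natDegree_weierstrassDistinguished :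
    (g.weierstrassDistinguished hg).natDegree = (g.map (IsLocalRing.residue A)).order.toNat :=
  (g.isWeierstrassFactorization_weierstrassDistinguished_weierstrassUnit hg).natDegree_eq_toNat_order_map

/-- `A⟦X⟧ ⧸ (g)` is a finitely generated `A`-module for `g mod 𝔪_A ≠ 0` (Weierstrass division over
the complete local ring `A`: `A⟦X⟧/(g) ≅ A[X]/(f)`, `f` the Weierstrass polynomial; Washington
Prop. 7.2 / Thm. 7.3). [cite: Washington1997, Prop. 7.2 and Thm. 7.3] -/
theorem finite_quotient : Module.Finite A (PowerSeries A ⧸ Ideal.span {g}) :=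
  haveI : Module.Finite A (A[X] ⧸ Ideal.span {g.weierstrassDistinguished hg}) :=
    (show Module.Finite A (AdjoinRoot (g.weierstrassDistinguished hg)) from
      (monic_weierstrassDistinguished hg).finite_adjoinRoot)
  Module.Finite.equiv (g.algEquivQuotientWeierstrassDistinguished hg).toLinearEquiv

/-- `A⟦X⟧ ⧸ (g)` is a free `A`-module for `g mod 𝔪_A ≠ 0` (basis `1, X, …, X^{d-1}`, `d` the
residual order). [cite: Washington1997, Prop. 7.2 and Thm. 7.3] -/
theorem free_quotient : Module.Free A (PowerSeries A ⧸ Ideal.span {g}) :=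
  haveI : Module.Free A (A[X] ⧸ Ideal.span {g.weierstrassDistinguished hg}) :=
    (show Module.Free A (AdjoinRoot (g.weierstrassDistinguished hg)) from
      Module.Free.of_basis (AdjoinRoot.powerBasis' (monic_weierstrassDistinguished hg)).basis)
  Module.Free.of_equiv (g.algEquivQuotientWeierstrassDistinguished hg).toLinearEquiv

/-- `rank_A A⟦X⟧ ⧸ (g) = ord (g mod 𝔪_A)` for `g mod 𝔪_A ≠ 0`. [cite: Washington1997, Prop. 7.2 and Thm. 7.3] -/
theorem finrank_quotient :
    Module.finrank A (PowerSeries A ⧸ Ideal.span {g}) = (g.map (IsLocalRing.residue A)).order.toNat := by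
  rw [← (g.algEquivQuotientWeierstrassDistinguished hg).toLinearEquiv.finrank_eq]
  change Module.finrank A (AdjoinRoot (g.weierstrassDistinguished hg)) = _
  rw [(AdjoinRoot.powerBasis' (monic_weierstrassDistinguished hg)).finrank,
    AdjoinRoot.powerBasis'_dim, natDegree_weierstrassDistinguished hg]

end Quotient

section PiQuotient

variable {A : Type*} [CommRing A] [IsLocalRing A] [IsAdicComplete (maximalIdeal A) A]
variable {ι : Type*} {G : ι → PowerSeries A} (hG : ∀ i, (G i).map (IsLocalRing.residue A) ≠ 0)
include hG

/-- For a finite family `g i` with `g i mod 𝔪_A ≠ 0`, the product `Π i, A⟦X⟧ ⧸ (g i)` — the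
elementary torsion `A⟦X⟧`-module `⨁ A⟦X⟧/(g i)` — is a finitely generated `A`-module. [folklore] -/
theorem finite_pi_quotient [Finite ι] : Module.Finite A (Π i, PowerSeries A ⧸ Ideal.span {G i}) :=
  haveI : ∀ i, Module.Finite A (PowerSeries A ⧸ Ideal.span {G i}) := fun i => finite_quotient (hG i)
  Module.Finite.pi

/-- For a finite family `g i` with `g i mod 𝔪_A ≠ 0`, the product `Π i, A⟦X⟧ ⧸ (g i)` is a free
`A`-module. [folklore] -/
theorem free_pi_quotient [Finite ι] : Module.Free A (Π i, PowerSeries A ⧸ Ideal.span {G i}) :=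
  haveI : ∀ i, Module.Free A (PowerSeries A ⧸ Ideal.span {G i}) := fun i => free_quotient (hG i)
  Module.Free.pi _ _

/-- `rank_A Π i, A⟦X⟧ ⧸ (g i) = ∑ i, ord (g i mod 𝔪_A)`. [folklore] -/
theorem finrank_pi_quotient [Fintype ι] :
    Module.finrank A (Π i, PowerSeries A ⧸ Ideal.span {G i}) =
      ∑ i, ((G i).map (IsLocalRing.residue A)).order.toNat := by
  haveI : ∀ i, Module.Free A (PowerSeries A ⧸ Ideal.span {G i}) := fun i => free_quotient (hG i)
  haveI : ∀ i, Module.Finite A (PowerSeries A ⧸ Ideal.span {G i}) := fun i => finite_quotient (hG i)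
  rw [Module.finrank_pi_fintype]
  exact Finset.sum_congr rfl fun i _ => finrank_quotient (hG i)

end PiQuotient

end Summit.BirchSwinnertonDyer.BirchSwinnertonDyer.Theorems.IwasawaTwoVariable

end
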